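/-
b2b-lace packet, LEAN TYPING SEAT 2 gen 14 (unit `b2b-lace-lean2-g14`).  REFEREE2 v54 ref2-R52 made precise IN THE KERNEL: the relation
between the certificate of record Cert rev 7 (`MeanFieldD11CertRev7`, p189017; hypotheses at the β-literals `Bi7/Bo7`) and its U(13,28)
INPUT-LEVEL TWIN (`MeanFieldD11InputsRev7`, p189406; hypotheses at the kernel-computed tables `β^corr(inputsI7)`, `β^corr(inputsO7)`).
ADDITIVE; no record file touched; no new definition; no named fact.
-/
import Literature.Probability.FitznerVanDerHofstad2017.MeanFieldD11InputsRev7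
import Literature.Probability.FitznerVanDerHofstad2017.NobleCertificateMono
import HarnessLib

/-!
# `d = 11`: the certificate of record FACTORS THROUGH THE INPUT LEVEL — `BetaLE Bi7 β^corr(inputsI7)`, `BetaLE Bo7 β^corr(inputsO7)`

CITATION HEADER (PLACEMENT v2). This module is part of a certified REPRODUCTION of:
R. Fitzner, R. van der Hofstad, *Mean-field behavior for nearest-neighbor percolation in d > 10*,
Electron. J. Probab. 22 (2017), no. 43, 1–65 [FvdH17], and *Generalized approach to the non-backtracking
lace expansion*, Probab. Theory Related Fields 169 (2017), 1041–1119 [NoBLE17] (arXiv:1506.07977, 1506.07969).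
Reproduces: nothing new from the papers — a kernel comparison of two tables of this packet. Origin: build `lace`.

WHAT THIS MODULE SAYS. The record (`D11.meanField_d11_cert_rev7`) and its input-level twin (`D11.meanField_d11_inputs_rev7`) are
DIFFERENT THEOREMS: the record's analytic hypotheses are stated at the β-LITERALS `Bi7`, `Bo7` (13+-digit outward roundings of the two
engines' certified β-intervals), the twin's at the tables `BetaMap.nobleBetaOfInputsCorr 11 inputsI7 / inputsO7` that the kernel computes,
through the typed D65-corrected [NoBLE17, App. D] map, from the 2 × 60 outward-rounded INPUT literals (REFEREE2 v54 DJA: 120/120 outward of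
both engines).  This module proves the sixteen inequalities
  `BetaLE Bi7 (β^corr(inputsI7))` and `BetaLE Bo7 (β^corr(inputsO7))`
(`NobleInstantiate.BetaLE`: every upper-bound constant of the right table is ≥ that of the left one and its `αFlow` is ≤; exact rational
arithmetic, `norm_num`; the differences are between 1e−16 and 9e−13 in absolute value, `cΦup` is `1 = 1`), i.e. the twin's tables are the
WEAKER ones.  Consequently, by the monotonicity lemmas `nobleInitialInputsAt_mono` / `nobleImprovementInputsAt_mono` ([NoBLE17] Assumption 2.7:
each β is a one-sided bound), the record's hypotheses IMPLY the twin's (`nobleInitialInputsAt_inputsI7_of_Bi7`,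
`nobleImprovementInputsAt_inputsO7_of_Bo7`), and the record's sentences are RE-DERIVED THROUGH THE INPUT LEVEL (three kernel-checked `example`s at the end of the module: the
statement of `meanField_d11_cert_rev7` — `NobleInitialInputsAt 11 Bi7 bi7 → NobleImprovementInputsAt 11 cMuC cWeightsC GammaC Bo7 bo7 →
TriangleCondition 11 ∧ PercolationContinuity 11 ∧ BetaEqOneBoundedRatio 11` — proved once through the twin (`Bi7/Bo7 —BetaLE→ β^corr(inputs·7)
—nobleCertificate_d11_inputs_rev7→ bootstrap`) and once by the record's own theorem (statement identity), and `… → MeanField 11` through the twin;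
`example`s because the gate admits no second declaration of a landed statement).  READING: the record's β-literals are not free-standing
numerals: they are dominated, field by field in the direction of [NoBLE17] Assumption 2.7, by the kernel's own evaluation of the Appendix-D map
at the enveloped Assumption-4.3 inputs, and the 36 certificate inequalities still close there (margins of `MeanFieldD11InputsRev7`).  The
converse brackets FAIL (`not_betaLE_inputsI7_Bi7`, `not_betaLE_inputsO7_Bo7`: the twin's `βμ` is strictly larger; in fact fourteen of the
sixteen fields are strict), so the converse implication (twin's hypotheses ⇒ record's) is NOT available by monotonicity and is not claimed.  Revision 2 adds the CERTIFICATE-LEVEL form of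
the same factorisation (a fourth `example`): the record's 36 inequalities `NobleNumericCertificate 11 cMuC cWeightsC gammaC7 GammaC Bi7 Bo7 bi7 bo7`
(statement of `D11.nobleCertificate_d11_rev7`) follow from the twin's `D11.nobleCertificate_d11_inputs_rev7` by the dimension-free monotonicity
`NobleNumericCertificate.of_betaLE` (`NobleCertificateMono`: [NoBLE17] Def. 2.9 is monotone under outward rounding) applied to the two brackets and
the sign conditions of `Bi7`, `Bo7` (`norm_num`).  Nothing here is a sentence about any dimension other than `d = 11`; the two analytic hypotheses keep the status
recorded in `MeanFieldD11CertRev7.lean` (ANALYTIC, NOT CITABLE, CONDITIONAL); the record is untouched.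
-/

noncomputable section

namespace Literature.Probability.FitznerVanDerHofstad2017
namespace D11

open Literature.Barriers.CriticalPhenomena Literature.Probability.Percolation

set_option maxHeartbeats 4000000 in
/-- The record's initial-point table `Bi7` is field-wise STRONGER than (`BetaLE`) the kernel-computed table of the input-level twin at
`inputsI7` (exact rational arithmetic). [cite: FitznerVanDerHofstad2016NoBLE, Assumption 2.7 (each β a one-sided bound) and App. D] -/
theorem betaLE_Bi7_inputsI7 : BetaLE Bi7 (BetaMap.nobleBetaOfInputsCorr 11 inputsI7) := by
  constructor <;>
    norm_num [Bi7, inputsI7, BetaMap.nobleBetaOfInputsCorr, BetaMap.betaRfDeltaCorr, BetaMap.nobleBetaOfInputs,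
      BetaMap.betaMubarOverMu, BetaMap.betaCPhiUp, BetaMap.betaAfLow, BetaMap.betaapI, BetaMap.betaapII, BetaMap.betaPiHat,
      BetaMap.betaPsiHatLower, BetaMap.betaRp, BetaMap.betaRfDeltaLower]

set_option maxHeartbeats 4000000 in
/-- The record's window table `Bo7` is field-wise STRONGER than (`BetaLE`) the kernel-computed table of the input-level twin at `inputsO7`
(exact rational arithmetic). [cite: FitznerVanDerHofstad2016NoBLE, Assumption 2.7 and App. D] -/
theorem betaLE_Bo7_inputsO7 : BetaLE Bo7 (BetaMap.nobleBetaOfInputsCorr 11 inputsO7) := by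
  constructor <;>
    norm_num [Bo7, inputsO7, BetaMap.nobleBetaOfInputsCorr, BetaMap.betaRfDeltaCorr, BetaMap.nobleBetaOfInputs,
      BetaMap.betaMubarOverMu, BetaMap.betaCPhiUp, BetaMap.betaAfLow, BetaMap.betaapI, BetaMap.betaapII, BetaMap.betaPiHat,
      BetaMap.betaPsiHatLower, BetaMap.betaRp, BetaMap.betaRfDeltaLower]

set_option maxHeartbeats 4000000 in
/-- The converse bracket FAILS at `p_I`: the twin's `βμ` is strictly larger than the record's. [folklore] -/
theorem not_betaLE_inputsI7_Bi7 : ¬ BetaLE (BetaMap.nobleBetaOfInputsCorr 11 inputsI7) Bi7 := fun h => by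
  have h1 := h.βμ
  norm_num [Bi7, inputsI7, BetaMap.nobleBetaOfInputsCorr, BetaMap.nobleBetaOfInputs, BetaMap.betaMubarOverMu] at h1

set_option maxHeartbeats 4000000 in
/-- The converse bracket FAILS on the window: the twin's `βμ` is strictly larger than the record's. [folklore] -/
theorem not_betaLE_inputsO7_Bo7 : ¬ BetaLE (BetaMap.nobleBetaOfInputsCorr 11 inputsO7) Bo7 := fun h => by
  have h1 := h.βμ
  norm_num [Bo7, inputsO7, BetaMap.nobleBetaOfInputsCorr, BetaMap.nobleBetaOfInputs, BetaMap.betaMubarOverMu] at h1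

/-- The record's (S2) hypothesis at `p_I` implies the twin's. [cite: FitznerVanDerHofstad2016NoBLE, Assumption 2.7, Prop. 4.5 (i)] -/
theorem nobleInitialInputsAt_inputsI7_of_Bi7 (hI : NobleInitialInputsAt 11 Bi7 bi7) :
    NobleInitialInputsAt 11 (BetaMap.nobleBetaOfInputsCorr 11 inputsI7) bi7 :=
  nobleInitialInputsAt_mono betaLE_Bi7_inputsI7 (fun _ => le_rfl) hI

/-- The record's improvement hypothesis on the window implies the twin's. [cite: FitznerVanDerHofstad2016NoBLE, Assumption 2.7, Prop. 4.5 (ii)] -/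
theorem nobleImprovementInputsAt_inputsO7_of_Bo7 (hS : NobleImprovementInputsAt 11 cMuC cWeightsC GammaC Bo7 bo7) :
    NobleImprovementInputsAt 11 cMuC cWeightsC GammaC (BetaMap.nobleBetaOfInputsCorr 11 inputsO7) bo7 :=
  nobleImprovementInputsAt_mono betaLE_Bo7_inputsO7 (fun _ => le_rfl) hS

/-! ### The record's `d = 11` sentences, re-derived THROUGH THE INPUT LEVEL (kernel-checked `example`s)

The two statements below are, verbatim, those of the record's `meanField_d11_cert_rev7` (`MeanFieldD11CertRev7`) and of
`OnPath`'s `D11.meanField_d11_cert_rev7_full`; they are therefore given as `example`s (the gate does not admit a second declaration of an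
already-landed statement), with the proof running `Bi7/Bo7 —BetaLE→ β^corr(inputs·7) —nobleCertificate_d11_inputs_rev7→ bootstrap → triangle →
exponents`.  CONDITIONAL exactly on the record's `hI`, `hS`.
[cite: FitznerVanDerHofstad2017, Thm 1.1 / Cor. 1.3 (d = 11); FitznerVanDerHofstad2016NoBLE, Def. 2.9, Prop. 2.11] -/

/- the record's sentence (statement of `meanField_d11_cert_rev7`), proved through the input-level twin -/
example (hI : NobleInitialInputsAt 11 Bi7 bi7) (hS : NobleImprovementInputsAt 11 cMuC cWeightsC GammaC Bo7 bo7) :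
    TriangleCondition 11 ∧ PercolationContinuity 11 ∧ BetaEqOneBoundedRatio 11 :=
  meanField_d11_inputs_rev7 (nobleInitialInputsAt_inputsI7_of_Bi7 hI) (nobleImprovementInputsAt_inputsO7_of_Bo7 hS)

/- the same statement, proved by the record's own theorem (statement identity check) -/
example (hI : NobleInitialInputsAt 11 Bi7 bi7) (hS : NobleImprovementInputsAt 11 cMuC cWeightsC GammaC Bo7 bo7) :
    TriangleCondition 11 ∧ PercolationContinuity 11 ∧ BetaEqOneBoundedRatio 11 :=
  meanField_d11_cert_rev7 hI hS

/- [FvdH17] Cor. 1.3 in full at `d = 11` (statement of `OnPath`'s `D11.meanField_d11_cert_rev7_full`), proved through the input-level twin -/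
example (hI : NobleInitialInputsAt 11 Bi7 bi7) (hS : NobleImprovementInputsAt 11 cMuC cWeightsC GammaC Bo7 bo7) : MeanField 11 :=
  meanField_full_d11_inputs_rev7 (nobleInitialInputsAt_inputsI7_of_Bi7 hI) (nobleImprovementInputsAt_inputsO7_of_Bo7 hS)

/- the record's numeric certificate (statement of `D11.nobleCertificate_d11_rev7`), derived from the input-level twin's certificate by
   monotonicity of Def. 2.9 under outward rounding (`NobleNumericCertificate.of_betaLE`) + the two brackets (revision 2) -/
example : NobleNumericCertificate 11 cMuC cWeightsC gammaC7 GammaC Bi7 Bo7 bi7 bo7 :=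
  nobleCertificate_d11_inputs_rev7.of_betaLE (by norm_num) betaLE_Bi7_inputsI7 betaLE_Bo7_inputsO7
    (by norm_num [Bi7]) (by norm_num [Bi7]) (by norm_num [Bi7]) (by norm_num [Bi7])
    (by norm_num [Bo7]) (by norm_num [Bo7]) (by norm_num [Bo7]) (by norm_num [Bo7])

/- statement identity: the record's own certificate theorem at the same statement -/
example : NobleNumericCertificate 11 cMuC cWeightsC gammaC7 GammaC Bi7 Bo7 bi7 bo7 := nobleCertificate_d11_rev7

end D11
end Literature.Probability.FitznerVanDerHofstad2017

end
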